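import Literature.MathematicalPhysics.QuantumFieldTheory.Balaban1983to89.B1TorusCubeBoxOp

/-!
# `Balaban1983to89.B1TorusRegionCubes` — [Balaban1983RegularityDecay] §2 (2.2)–(2.12) pp. 575–577 FOR A REGION `Ω ⊂ T_ε` OF THE
# (Higgs)₂,₃ CARRIER OF [Balaban1982Higgs1] (2.20): the pieces «□_j = Ω ∩ {a sum of large blocks for which the point Mj is one of
# the vertices}», interior cubes with «Ã_j = A₀ + θ_jA′» and boundary pieces with «Ã_j = A», the locality identity **(2.6)** for the
# region operator `−Δ^{ε,N}_{A,Ω} + m² + a_K(L^Kε)^{−2}P_K(A)`, the letters `h_jG_jh_j`, `K_jG_jh_j` of (2.2)/(2.10)–(2.11) as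
# elements of the endomorphism ring, and the representation **(2.12)** `G_K(Ω,A) = G₀ + G_K(Ω,A)·R` — the algebraic half of the
# region programme of this lineage (gens 8–11 treated `Ω = T_ε`, where every cube is interior)

statement-level skeleton of published theorems with citation tags; proofs where landed; nothing here is a claim about the Yang–Mills mass gap

PDF held: `paper:balaban1983-cmp89-regularity-decay` pp. 573, 575–579 [PDF 3, 5–9] (text layer re-read by this seat);
`paper:balaban1982-cmp85-higgs23-i` pp. 610–611 [PDF 8–9].

CITATION HEADER (lean-in-tree rule).  T. Bałaban, *Regularity and decay of lattice Green's functions*, Commun. Math. Phys. **89**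
(1983) 571–597 [Balaban1983RegularityDecay] (§2 pp. 575–577: the cubes `□_j`, the partition `h_j`, the configurations `Ã_j`, (2.2),
(2.6), (2.9)–(2.12)) and T. Bałaban, *(Higgs)₂,₃ quantum fields in a finite volume. I*, Commun. Math. Phys. **85** (1982) 603–626
[Balaban1982Higgs1] ((2.20) p. 610 the operator, Prop. 2.1 pp. 610–611 the consumer).  Cell `lit-balaban` (HOME
`run/shared/lean/pub/lit-balaban/`), Phase-2 proof seat **p35** gen 12 (unit `lit-balaban-p35`); SKELETON rows **B4.Eq2.2**,
**B4.Eq2.6**, **B4.Eq2.10**, **B4.Eq2.12** (model instances FOR REGIONS on the (Higgs)₂,₃ carrier) feeding **B1.Prop2.1** /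
**B4.Thm@573** for regions `Ω ⊊ T_ε` at a regular `A ≠ 0` (the scope gap recorded in gen 11's `B1Prop21RegularTorusFam` HONEST
SCOPE).  USED BY NAME, never restated: the typer's `HiggsCovariance.{covLaplacianN, fwdTerm, bwdTerm, projPk, covOpK, propagatorK}`,
`HiggsCovariancePos.{isUnit_covOpK, covOpK_mul_propagatorK, propagatorK_mul_covOpK, shift_unshift}`, this seat's gen-8
`B1TorusCubeCover` (labels `Lab`, `cube`, `Near`, `hTor`, `thetaTor`, `sum_hTor_sq`, multiplicity), `B1TorusCubeLocality26`
(`rS`, `cubeVec`, `fwdTerm_apply`, …, `projPk_hTor_agree`, the `Near rS` support lemmas), `B1TorusCubeChart.mem_cube_of_blockIter_eq`,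
and `B4Eq212SupNeumann.parametrix_identity` ((2.9)–(2.11), abstract).

WHAT IS PRINTED (pp. 575–577, verbatim up to OCR).  p. 575: *«We have assumed that Ω^{(k)} is a sum of large blocks … For each
j ∈ Z^d, let us define the set □_j = Ω ∩ {a sum of large blocks for which the point Mj is one of the vertices}. Let us observe
that if the point Mj is not a boundary point of Ω, then □_j is a cube of the size 2M and with center in Mj. For Mj lying on the
boundary the set □_j is a sum of several (< 2^d) large blocks. … Let us define an operator G₀ by the formula
G₀ = Σ_j h_jG_k(□_j, A_j)h_j, (2.2) where the configurations A_j are constructed in the following way: if □_j intersects the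
boundary of Ω, then A_j = A; if □_j is an interior cube of Ω, then we take A_j as equal to A on the cube {x : |x − Mj| ≤ ¾M}, and
changing regularly to a constant function in a neighbourhood of a boundary of □_j.»*  p. 576: *«(−Δ^{η,N}_{A,Ω})h_jG(□_j, A_j) =
(−Δ^{η,N}_{A_j,□_j})h_jG(□_j, A_j), (2.6) because the function h_j can be ≠ 0 only on the part of the boundary of □_j which is
contained in the boundary of Ω.»*  p. 577: *«R is a small operator in reasonable norms … so we have the representations
G_k(Ω, A) = G₀(I − R)^{−1} = Σ_{n=0}^∞ G₀Rⁿ. (2.12)»*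

WHAT THIS FILE PROVES (kernel-checked, zero `sorry`; definitions with bodies + theorems; no `def … : Prop` fact).
* §1 `piece Ω j = Ω ∩ □_j` (the window `□_j` of gen 8 = «a sum of large blocks for which Mj is one of the vertices»); the local
  field `fld Ω A j` (`= cubeVec j A = A₀ + θ_jA′` if `□_j ⊆ Ω`, `= A` otherwise — the two printed cases); the local operators
  `Hloc`/`Gloc` = (2.20) on the piece with the local field; `piece_blockSat` (a piece of a union of `K`-blocks is a union of
  `K`-blocks — the hypothesis of r14's region coercivity `B1Ineq18RegularRegion`); `Hloc_mul_Gloc`, `Gloc_mul_Hloc` (`m² > 0`).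
* §2 **(2.6) FOR A REGION**: `covLaplacianN_hTor_agree_region` (any `Ω`, any local field agreeing with `A` on `{|x − Mj| ≦ rS}`) and
  **`covOpK_hTor_agree_region`**: `(−Δ^{ε,N}_{A,Ω} + m² + a_K(L^Kε)^{−2}P_K(A))(h_jψ) = H_j(h_jψ)` for EVERY `Ω ⊂ T_ε`, `j`, `A`, `ψ`.
* §3 `commutator_row_zero_gen` — the rows of `K_j = [H_j, h_j]` lie in `{|x − Mj| ≦ rS}` for every piece and field.
* §4 the letters in `Module.End`: `mulOp h` (multiplication by `h_j`), `aOp j = h_jG_jh_j`, `commOp j = H_jh_j − h_jH_j`,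
  `bOp j = −(commOp j)G_jh_j`, `G0 = Σ_j aOp j` (2.2), `Rop = Σ_j bOp j` (2.11); **`covOpK_mul_G0`**: `H·G₀ = 1 − R` ((2.9)–(2.11))
  and **`propagatorK_eq_G0_add`**: `G_K(Ω,A) = G₀ + G_K(Ω,A)·R` — (2.12) as the identity behind «G₀(I − R)^{−1}».
* §5 supports and locality: `aOp`/`bOp` outputs live in `{|x − Mj| ≦ rS}` and see their input only there; hence
  `aOp_mul_bOp_eq_zero`, `bOp_mul_bOp_eq_zero` for cubes whose `rS`-cores are disjoint (the «obvious fact» behind (2.13)),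
  `aOp_apply_norm_le` (the probe bound `‖(h_jG_jh_jg)(x)‖ ≦ γ‖g‖_∞` from a sup letter) and the `2^d` multiplicity restated for
  the cores.
HONEST SCOPE.  Algebra and supports only: no estimate on any letter is proved here (the sup/`L^p` letters at interior cubes are
gen 8–10's per-cube theorems and their graded sequel; the `L²` letters at boundary pieces are Lemma 2.1 for this carrier, the next
file); `Ω` is an ARBITRARY finite set of sites for §§2–5 (the print's «sum of large blocks» is needed only for the estimates);
`m² > 0`, `a_K ≧ 0`, `K ≦ K_P`, `K₀ ∣ M_P`, `K₀ ≧ 8` as in gens 8–11.  Unit `lit-balaban-p35` gen 12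
(literature-prover-lit-balaban-p35-g12-0).
-/

open scoped BigOperators

noncomputable section

namespace Literature.MathematicalPhysics.QuantumFieldTheory.Balaban1983to89.B1TorusRegionCubes

open Literature.MathematicalPhysics.QuantumFieldTheory.Balaban1983to89.HiggsLattice
open Literature.MathematicalPhysics.QuantumFieldTheory.Balaban1983to89.HiggsAveraging
open Literature.MathematicalPhysics.QuantumFieldTheory.Balaban1983to89.HiggsCovariance
open Literature.MathematicalPhysics.QuantumFieldTheory.Balaban1983to89.HiggsCovariancePos
  (shift_unshift unshift_shift isUnit_covOpK covOpK_mul_propagatorK propagatorK_mul_covOpK)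
open Literature.MathematicalPhysics.QuantumFieldTheory.Balaban1983to89.B1TorusCubeCover
open Literature.MathematicalPhysics.QuantumFieldTheory.Balaban1983to89.B1TorusCubeLocality26
open Literature.MathematicalPhysics.QuantumFieldTheory.Balaban1983to89.B1TorusCubeChart (mem_cube_of_blockIter_eq)
open Literature.MathematicalPhysics.QuantumFieldTheory.Balaban1983to89.B4Eq212SupNeumann (parametrix_identity)

variable {P : HiggsLattice.Params} {N : ℕ}

/-- `K₀ ≥ 8 ⇒ K₀ ≥ 1`. [folklore] -/
private theorem one_le_of_eight_le {K₀ : ℕ} (hK₀8 : 8 ≤ K₀) : 1 ≤ K₀ := le_trans (by norm_num) hK₀8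

/-! ## §1 The pieces `Ω ∩ □_j`, the local fields and the local operators -/

section Pieces

variable (C : ChargeData N) (K K₀ : ℕ)

/-- **«□_j = Ω ∩ {a sum of large blocks for which the point Mj is one of the vertices}»**: the piece of the region `Ω` in the
window `□_j` of gen 8 (`B1TorusCubeCover.cube`: the `2M`-cube centred at `Mj`, which IS the union of the `2^d` large blocks with
vertex `Mj`). [cite: Balaban1983RegularityDecay, §2 p.575] -/
def piece (Ω : Finset (HiggsLattice.Site P 0)) (j : Lab P K K₀) : Finset (HiggsLattice.Site P 0) := Ω ∩ cube K K₀ j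

/-- **THE LOCAL FIELD `A_j`**: «if □_j intersects the boundary of Ω, then A_j = A; if □_j is an interior cube of Ω, then … Ã_j =
A₀ + θ_jA′» (gen 8's `cubeVec`). Interior = `□_j ⊆ Ω`. [cite: Balaban1983RegularityDecay, §2 p.575] -/
def fld (Ω : Finset (HiggsLattice.Site P 0)) (A : HiggsLattice.VecField P 0) (j : Lab P K K₀) : HiggsLattice.VecField P 0 :=
  if cube K K₀ j ⊆ Ω then cubeVec K K₀ j A else A

variable {K K₀}

/-- Unfolding of `piece`. [cite: Balaban1983RegularityDecay, §2 p.575] -/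
theorem mem_piece {Ω : Finset (HiggsLattice.Site P 0)} {j : Lab P K K₀} {x : HiggsLattice.Site P 0} :
    x ∈ piece K K₀ Ω j ↔ x ∈ Ω ∧ x ∈ cube K K₀ j := Finset.mem_inter

/-- «if the point Mj is not a boundary point of Ω, then □_j is a cube of the size 2M»: for an interior label the piece is the
whole window. [cite: Balaban1983RegularityDecay, §2 p.575] -/
theorem piece_eq_cube_of_good {Ω : Finset (HiggsLattice.Site P 0)} {j : Lab P K K₀} (h : cube K K₀ j ⊆ Ω) :
    piece K K₀ Ω j = cube K K₀ j :=
  Finset.inter_eq_right.mpr h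

/-- The piece lies in the region. [cite: Balaban1983RegularityDecay, §2 p.575] -/
theorem piece_subset (Ω : Finset (HiggsLattice.Site P 0)) (j : Lab P K K₀) : piece K K₀ Ω j ⊆ Ω := Finset.inter_subset_left

/-- The piece lies in the window. [cite: Balaban1983RegularityDecay, §2 p.575] -/
theorem piece_subset_cube (Ω : Finset (HiggsLattice.Site P 0)) (j : Lab P K K₀) : piece K K₀ Ω j ⊆ cube K K₀ j :=
  Finset.inter_subset_right

/-- The local field at an interior label. [cite: Balaban1983RegularityDecay, §2 p.575] -/
theorem fld_of_good {Ω : Finset (HiggsLattice.Site P 0)} {A : HiggsLattice.VecField P 0} {j : Lab P K K₀} (h : cube K K₀ j ⊆ Ω) :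
    fld K K₀ Ω A j = cubeVec K K₀ j A := if_pos h

/-- The local field at a boundary label. [cite: Balaban1983RegularityDecay, §2 p.575] -/
theorem fld_of_bad {Ω : Finset (HiggsLattice.Site P 0)} {A : HiggsLattice.VecField P 0} {j : Lab P K K₀} (h : ¬ cube K K₀ j ⊆ Ω) :
    fld K K₀ Ω A j = A := if_neg h

/-- «A_j as equal to A on the cube {x : |x − Mj| ≤ ¾M}»: the local field agrees with `A` on every bond starting within `rS` of
`Mj` (both cases). [cite: Balaban1983RegularityDecay, §2 p.575] -/
theorem fld_apply_of_near (hK : K ≤ P.K) (hK₀ : K₀ ∣ P.M) (hK₀8 : 8 ≤ K₀) (Ω : Finset (HiggsLattice.Site P 0))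
    (A : HiggsLattice.VecField P 0) (j : Lab P K K₀) {x : HiggsLattice.Site P 0} (hx : Near K K₀ (rS P K K₀) j x) (μ : Fin P.d) :
    fld K K₀ Ω A j ⟨x, μ⟩ = A ⟨x, μ⟩ := by
  unfold fld
  split_ifs
  · exact cubeVec_apply_of_thetaTor_eq_one (thetaTor_eq_one_of_near_rS hK hK₀ hK₀8 hx)
  · rfl

/-- **A PIECE OF A UNION OF `K`-BLOCKS IS A UNION OF `K`-BLOCKS** (the window is one, `B1TorusCubeChart.mem_cube_of_blockIter_eq`;
`3M ≤ |T_ε|_μ`) — the shape hypothesis of r14's region coercivity (1.8). [cite: Balaban1983RegularityDecay, §2 p.575] -/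
theorem piece_blockSat (hK : K ≤ P.K) (hK₀ : K₀ ∣ P.M) (hK₀' : 1 ≤ K₀) (hN3 : ∀ μ, 3 * half P K K₀ ≤ P.sitesPerDir 0 μ)
    {Ω : Finset (HiggsLattice.Site P 0)}
    (hΩ : ∀ x x' : HiggsLattice.Site P 0, blockIter K x = blockIter K x' → (x ∈ Ω ↔ x' ∈ Ω)) (j : Lab P K K₀) :
    ∀ x x' : HiggsLattice.Site P 0, blockIter K x = blockIter K x' → (x ∈ piece K K₀ Ω j ↔ x' ∈ piece K K₀ Ω j) := by
  intro x x' h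
  rw [mem_piece, mem_piece, hΩ x x' h]
  exact and_congr_right fun _ =>
    ⟨fun hx => mem_cube_of_blockIter_eq hK hK₀ hK₀' hN3 j hx h.symm, fun hx' => mem_cube_of_blockIter_eq hK hK₀ hK₀' hN3 j hx' h⟩

variable (K K₀)

/-- **THE LOCAL OPERATOR `H_j = −Δ^{ε,N}_{A_j,□_j} + m² + a_K(L^Kε)^{−2}P_K(A_j)`** on the piece `Ω ∩ □_j` with the local field.
[cite: Balaban1983RegularityDecay, (2.2) p.575] [cite: Balaban1982Higgs1, (2.20) p.610] -/
def Hloc (Ω : Finset (HiggsLattice.Site P 0)) (A : HiggsLattice.VecField P 0) (msq a : ℝ) (j : Lab P K K₀) :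
    Module.End ℝ (HiggsLattice.ScalarField P 0 N) :=
  covOpK C (piece K K₀ Ω j) (fld K K₀ Ω A j) msq a K

/-- **THE LOCAL PROPAGATOR `G_j = G_k(□_j, A_j)`** of (2.2) on the piece with the local field. [cite: Balaban1983RegularityDecay, (2.2) p.575]
[cite: Balaban1982Higgs1, (2.20) p.610] -/
def Gloc (Ω : Finset (HiggsLattice.Site P 0)) (A : HiggsLattice.VecField P 0) (msq a : ℝ) (j : Lab P K K₀) :
    Module.End ℝ (HiggsLattice.ScalarField P 0 N) :=
  propagatorK C (piece K K₀ Ω j) (fld K K₀ Ω A j) msq a K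

variable {C K K₀}

/-- `H_jG_j = 1` (`m² > 0`, `a_K ≥ 0`). [cite: Balaban1982Higgs1, (2.20) p.610] -/
theorem Hloc_mul_Gloc (Ω : Finset (HiggsLattice.Site P 0)) (A : HiggsLattice.VecField P 0) {msq : ℝ} (hmsq : 0 < msq) (a : ℝ)
    (hak : 0 ≤ B1.aSeq a P.L K) (j : Lab P K K₀) :
    Hloc C K K₀ Ω A msq a j * Gloc C K K₀ Ω A msq a j = 1 :=
  covOpK_mul_propagatorK C _ _ hmsq a K hak

/-- `G_jH_j = 1` (`m² > 0`, `a_K ≥ 0`). [cite: Balaban1982Higgs1, (2.20) p.610] -/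
theorem Gloc_mul_Hloc (Ω : Finset (HiggsLattice.Site P 0)) (A : HiggsLattice.VecField P 0) {msq : ℝ} (hmsq : 0 < msq) (a : ℝ)
    (hak : 0 ≤ B1.aSeq a P.L K) (j : Lab P K K₀) :
    Gloc C K K₀ Ω A msq a j * Hloc C K K₀ Ω A msq a j = 1 :=
  propagatorK_mul_covOpK C _ _ hmsq a K hak

end Pieces

/-! ## §2 (2.6) for a region: `H_Ω(h_jψ) = H_j(h_jψ)` -/

section Agreement

variable (C : ChargeData N) {K K₀ : ℕ}

/-- **(2.6) FOR THE NEUMANN LAPLACIAN OF A REGION**: for ANY `Ω ⊂ T_ε` and any field `A′` agreeing with `A` on the bonds starting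
within `rS` of `Mj`, `−Δ^{ε,N}_{A,Ω}(h_jψ) = −Δ^{ε,N}_{A′,Ω∩□_j}(h_jψ)` — «because the function h_j can be ≠ 0 only on the part of the
boundary of □_j which is contained in the boundary of Ω»: a bond of `Ω` with an end outside `□_j` has `h_j = 0` at both ends.
[cite: Balaban1983RegularityDecay, (2.6) p.576] -/
theorem covLaplacianN_hTor_agree_region (hK : K ≤ P.K) (hK₀ : K₀ ∣ P.M) (hK₀8 : 8 ≤ K₀) (Ω : Finset (HiggsLattice.Site P 0))
    (j : Lab P K K₀) (A A' : HiggsLattice.VecField P 0)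
    (hA' : ∀ (x : HiggsLattice.Site P 0) (μ : Fin P.d), Near K K₀ (rS P K K₀) j x → A' ⟨x, μ⟩ = A ⟨x, μ⟩)
    (ψ : HiggsLattice.ScalarField P 0 N) :
    covLaplacianN C Ω A (hTor K K₀ j • ψ) = covLaplacianN C (Ω ∩ cube K K₀ j) A' (hTor K K₀ j • ψ) := by
  funext x
  rw [covLaplacianN_apply, covLaplacianN_apply]
  congr 1
  refine Finset.sum_congr rfl fun μ _ => ?_
  congr 1
  · -- forward bond term
    rw [fwdTerm_apply, fwdTerm_apply]
    by_cases h0 : hTor K K₀ j x = 0 ∧ hTor K K₀ j (x.shift μ) = 0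
    · have e1 : (hTor K K₀ j • ψ) x = 0 := by rw [Pi.smul_apply', h0.1, zero_smul]
      have e2 : (hTor K K₀ j • ψ) (x.shift μ) = 0 := by rw [Pi.smul_apply', h0.2, zero_smul]
      rw [e1, e2]; split_ifs <;> simp
    · have hx : Near K K₀ (rS P K K₀) j x := by
        by_cases h1 : hTor K K₀ j x = 0
        · exact near_rS_of_hTor_shift_ne_zero hK hK₀ hK₀8 (fun h2 => h0 ⟨h1, h2⟩)
        · exact near_rS_of_hTor_ne_zero hK hK₀ hK₀8 h1
      obtain ⟨hc0, hc1, -⟩ := mem_cube_of_near hK₀8 hx μ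
      have hiff : (x ∈ Ω ∩ cube K K₀ j ∧ x.shift μ ∈ Ω ∩ cube K K₀ j) ↔ (x ∈ Ω ∧ x.shift μ ∈ Ω) := by
        simp only [Finset.mem_inter, hc0, hc1, and_true]
      rw [hA' x μ hx]
      by_cases hΩ : x ∈ Ω ∧ x.shift μ ∈ Ω
      · rw [if_pos hΩ, if_pos (hiff.mpr hΩ)]
      · rw [if_neg hΩ, if_neg (fun h => hΩ (hiff.mp h))]
  · -- backward bond term
    rw [bwdTerm_apply, bwdTerm_apply]
    by_cases h0 : hTor K K₀ j x = 0 ∧ hTor K K₀ j (x.unshift μ) = 0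
    · have e1 : (hTor K K₀ j • ψ) x = 0 := by rw [Pi.smul_apply', h0.1, zero_smul]
      have e2 : (hTor K K₀ j • ψ) (x.unshift μ) = 0 := by rw [Pi.smul_apply', h0.2, zero_smul]
      rw [e1, e2]; split_ifs <;> simp
    · have hx : Near K K₀ (rS P K K₀) j x := by
        by_cases h1 : hTor K K₀ j x = 0
        · exact near_rS_of_hTor_unshift_ne_zero hK hK₀ hK₀8 (fun h2 => h0 ⟨h1, h2⟩)
        · exact near_rS_of_hTor_ne_zero hK hK₀ hK₀8 h1
      obtain ⟨hc0, -, hc2⟩ := mem_cube_of_near hK₀8 hx μ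
      have hxu : Near K K₀ (rS P K K₀) j (x.unshift μ) := by
        by_cases h1 : hTor K K₀ j (x.unshift μ) = 0
        · have h2 : hTor K K₀ j x ≠ 0 := fun h2 => h0 ⟨h2, h1⟩
          have h3 : hTor K K₀ j ((x.unshift μ).shift μ) ≠ 0 := by rwa [shift_unshift]
          exact near_rS_of_hTor_shift_ne_zero hK hK₀ hK₀8 h3
        · exact near_rS_of_hTor_ne_zero hK hK₀ hK₀8 h1
      have hiff : (x ∈ Ω ∩ cube K K₀ j ∧ x.unshift μ ∈ Ω ∩ cube K K₀ j) ↔ (x ∈ Ω ∧ x.unshift μ ∈ Ω) := by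
        simp only [Finset.mem_inter, hc0, hc2, and_true]
      rw [hA' (x.unshift μ) μ hxu]
      by_cases hΩ : x ∈ Ω ∧ x.unshift μ ∈ Ω
      · rw [if_pos hΩ, if_pos (hiff.mpr hΩ)]
      · rw [if_neg hΩ, if_neg (fun h => hΩ (hiff.mp h))]

/-- **(2.6) FOR THE REGION OPERATOR OF (2.20), BOTH PRINTED CASES OF `A_j`**: for EVERY `Ω ⊂ T_ε`, label `j`, field `A` and `ψ`,
`(−Δ^{ε,N}_{A,Ω} + m² + a_K(L^Kε)^{−2}P_K(A))(h_jψ) = (−Δ^{ε,N}_{A_j,Ω∩□_j} + m² + a_K(L^Kε)^{−2}P_K(A_j))(h_jψ) = H_j(h_jψ)`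
(`K ≤ K_P`, `K₀ ∣ M_P`, `K₀ ≥ 8`; the `P_K` part is gen 8's `projPk_hTor_agree` at interior labels and trivial at boundary labels).
[cite: Balaban1983RegularityDecay, (2.6) p.576] [cite: Balaban1982Higgs1, (2.20) p.610] -/
theorem covOpK_hTor_agree_region (hK : K ≤ P.K) (hK₀ : K₀ ∣ P.M) (hK₀8 : 8 ≤ K₀) (Ω : Finset (HiggsLattice.Site P 0))
    (j : Lab P K K₀) (A : HiggsLattice.VecField P 0) (msq a : ℝ) (ψ : HiggsLattice.ScalarField P 0 N) :
    covOpK C Ω A msq a K (hTor K K₀ j • ψ) = Hloc C K K₀ Ω A msq a j (hTor K K₀ j • ψ) := by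
  unfold Hloc piece
  have hL := covLaplacianN_hTor_agree_region C hK hK₀ hK₀8 Ω j A (fld K K₀ Ω A j)
    (fun x μ hx => fld_apply_of_near hK hK₀ hK₀8 Ω A j hx μ) ψ
  have hPk : projPk C A K (hTor K K₀ j • ψ) = projPk C (fld K K₀ Ω A j) K (hTor K K₀ j • ψ) := by
    unfold fld
    split_ifs
    · exact projPk_hTor_agree C hK hK₀ hK₀8 j A ψ
    · rfl
  simp only [covOpK, LinearMap.add_apply, LinearMap.smul_apply, LinearMap.id_apply, hL, hPk]

end Agreement

/-! ## §3 Row support of the commutator `K_j = [H_j, h_j]` for every piece and field -/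

section Rows

variable (C : ChargeData N) {K K₀ : ℕ}

/-- **ROW SUPPORT OF `K_j`, GENERAL PIECE AND FIELD**: for every finite `Ω′ ⊂ T_ε` and every field `A′`, off `{|x − Mj| ≤ rS}` the
field `H(h_jθ) − h_jHθ` of the operator `H = −Δ^{ε,N}_{A′,Ω′} + m² + a_K(L^Kε)^{−2}P_K(A′)` vanishes (there `h_j`, its lattice
neighbours' values and the values on the `K`-block all vanish; gen 8's `commutator_row_zero` is the case `Ω′ = □_j`, `A′ = Ã_j`).
[cite: Balaban1983RegularityDecay, (2.7) p.576, (2.10) p.576] -/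
theorem commutator_row_zero_gen (hK : K ≤ P.K) (hK₀ : K₀ ∣ P.M) (hK₀8 : 8 ≤ K₀) (j : Lab P K K₀)
    (Ω' : Finset (HiggsLattice.Site P 0)) (A' : HiggsLattice.VecField P 0) (msq a : ℝ) (θ : HiggsLattice.ScalarField P 0 N)
    {x : HiggsLattice.Site P 0} (hx : ¬ Near K K₀ (rS P K K₀) j x) :
    (covOpK C Ω' A' msq a K (hTor K K₀ j • θ) - hTor K K₀ j • covOpK C Ω' A' msq a K θ) x = 0 := by
  have h0 : hTor K K₀ j x = 0 := by
    by_contra h; exact hx (near_rS_of_hTor_ne_zero hK hK₀ hK₀8 h)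
  have hsh : ∀ μ, hTor K K₀ j (x.shift μ) = 0 := fun μ => by
    by_contra h; exact hx (near_rS_of_hTor_shift_ne_zero hK hK₀ hK₀8 h)
  have hush : ∀ μ, hTor K K₀ j (x.unshift μ) = 0 := fun μ => by
    by_contra h; exact hx (near_rS_of_hTor_unshift_ne_zero hK hK₀ hK₀8 h)
  have hbl : ∀ x' ∈ blockK K (blockIter K x), hTor K K₀ j x' = 0 := fun x' hx' => by
    by_contra h
    rw [mem_blockK] at hx'
    exact hx (near_rS_of_block hK hK₀ hK₀8 h hx'.symm)
  rw [Pi.sub_apply, Pi.smul_apply', h0, zero_smul, sub_zero]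
  simp only [covOpK, LinearMap.add_apply, LinearMap.smul_apply, LinearMap.id_apply, Pi.add_apply, Pi.smul_apply]
  have e0 : (hTor K K₀ j • θ) x = 0 := by rw [Pi.smul_apply', h0, zero_smul]
  have eL : covLaplacianN C Ω' A' (hTor K K₀ j • θ) x = 0 := by
    rw [covLaplacianN_apply]
    refine smul_eq_zero_of_right _ (Finset.sum_eq_zero fun μ _ => ?_)
    have e1 : (hTor K K₀ j • θ) (x.shift μ) = 0 := by rw [Pi.smul_apply', hsh μ, zero_smul]
    have e2 : (hTor K K₀ j • θ) (x.unshift μ) = 0 := by rw [Pi.smul_apply', hush μ, zero_smul]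
    rw [fwdTerm_apply, bwdTerm_apply, e0, e1, e2]
    split_ifs <;> simp
  have eP : projPk C A' K (hTor K K₀ j • θ) x = 0 := by
    rw [projPk_apply, Finset.sum_eq_zero fun x' hx' => by rw [Pi.smul_apply', hbl x' hx', zero_smul, map_zero]]
    simp
  rw [eL, e0, eP, smul_zero, smul_zero, add_zero, add_zero]

/-- Row support of `K_j` for the local operator `H_j` of the region programme. [cite: Balaban1983RegularityDecay, (2.10) p.576] -/
theorem Hloc_commutator_row_zero (hK : K ≤ P.K) (hK₀ : K₀ ∣ P.M) (hK₀8 : 8 ≤ K₀) (Ω : Finset (HiggsLattice.Site P 0))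
    (A : HiggsLattice.VecField P 0) (msq a : ℝ) (j : Lab P K K₀) (θ : HiggsLattice.ScalarField P 0 N)
    {x : HiggsLattice.Site P 0} (hx : ¬ Near K K₀ (rS P K K₀) j x) :
    (Hloc C K K₀ Ω A msq a j (hTor K K₀ j • θ) - hTor K K₀ j • Hloc C K K₀ Ω A msq a j θ) x = 0 :=
  commutator_row_zero_gen C hK hK₀ hK₀8 j _ _ msq a θ hx

end Rows

/-! ## §4 The letters of (2.2), (2.10)–(2.11) in the endomorphism ring and the representation (2.12) -/

section Letters

variable (C : ChargeData N) (K K₀ : ℕ)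

/-- MULTIPLICATION BY A REAL LATTICE FUNCTION as an endomorphism of the fields (`h_j·` in (2.2)). [cite: Balaban1983RegularityDecay, (2.2) p.575] -/
def mulOp (h : HiggsLattice.Site P 0 → ℝ) : Module.End ℝ (HiggsLattice.ScalarField P 0 N) where
  toFun ψ := h • ψ
  map_add' ψ φ := by funext x; simp only [Pi.smul_apply', Pi.add_apply, smul_add]
  map_smul' c ψ := by funext x; simp only [Pi.smul_apply', Pi.smul_apply, RingHom.id_apply, smul_comm (h x) c]

/-- THE LETTER `h_jG_jh_j` OF (2.2). [cite: Balaban1983RegularityDecay, (2.2) p.575] -/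
def aOp (Ω : Finset (HiggsLattice.Site P 0)) (A : HiggsLattice.VecField P 0) (msq a : ℝ) (j : Lab P K K₀) :
    Module.End ℝ (HiggsLattice.ScalarField P 0 N) :=
  mulOp (N := N) (hTor K K₀ j) * Gloc C K K₀ Ω A msq a j * mulOp (N := N) (hTor K K₀ j)

/-- THE COMMUTATOR `H_jh_j − h_jH_j` ((2.7)/(2.10): the print's `K_j` up to the printed sign convention). [cite: Balaban1983RegularityDecay, (2.10) p.576] -/
def commOp (Ω : Finset (HiggsLattice.Site P 0)) (A : HiggsLattice.VecField P 0) (msq a : ℝ) (j : Lab P K K₀) :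
    Module.End ℝ (HiggsLattice.ScalarField P 0 N) :=
  Hloc C K K₀ Ω A msq a j * mulOp (N := N) (hTor K K₀ j) - mulOp (N := N) (hTor K K₀ j) * Hloc C K K₀ Ω A msq a j

/-- THE LETTER OF `R` (2.11): `−K_jG_k(□_j,A_j)h_j` with `K_j` the commutator. [cite: Balaban1983RegularityDecay, (2.11) p.576] -/
def bOp (Ω : Finset (HiggsLattice.Site P 0)) (A : HiggsLattice.VecField P 0) (msq a : ℝ) (j : Lab P K K₀) :
    Module.End ℝ (HiggsLattice.ScalarField P 0 N) :=
  -(commOp C K K₀ Ω A msq a j * Gloc C K K₀ Ω A msq a j * mulOp (N := N) (hTor K K₀ j))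

/-- **`G₀ = Σ_j h_jG_k(□_j, A_j)h_j` (2.2).** [cite: Balaban1983RegularityDecay, (2.2) p.575] -/
def G0 (Ω : Finset (HiggsLattice.Site P 0)) (A : HiggsLattice.VecField P 0) (msq a : ℝ) :
    Module.End ℝ (HiggsLattice.ScalarField P 0 N) :=
  ∑ j : Lab P K K₀, aOp C K K₀ Ω A msq a j

/-- **`R = −Σ_j K_jG_k(□_j, A_j)h_j` (2.11).** [cite: Balaban1983RegularityDecay, (2.11) p.576] -/
def Rop (Ω : Finset (HiggsLattice.Site P 0)) (A : HiggsLattice.VecField P 0) (msq a : ℝ) :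
    Module.End ℝ (HiggsLattice.ScalarField P 0 N) :=
  ∑ j : Lab P K K₀, bOp C K K₀ Ω A msq a j

variable {C K K₀}
variable (Ω : Finset (HiggsLattice.Site P 0)) (A : HiggsLattice.VecField P 0) (msq a : ℝ)

/-- `mulOp h ψ = h·ψ`. [cite: Balaban1983RegularityDecay, (2.2) p.575] -/
@[simp] theorem mulOp_apply (h : HiggsLattice.Site P 0 → ℝ) (ψ : HiggsLattice.ScalarField P 0 N) :
    mulOp (N := N) h ψ = h • ψ := rfl

/-- `(h_jG_jh_j)ψ = h_j·G_j(h_jψ)`. [cite: Balaban1983RegularityDecay, (2.2) p.575] -/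
theorem aOp_apply (j : Lab P K K₀) (ψ : HiggsLattice.ScalarField P 0 N) :
    aOp C K K₀ Ω A msq a j ψ = hTor K K₀ j • Gloc C K K₀ Ω A msq a j (hTor K K₀ j • ψ) := rfl

/-- `(H_jh_j − h_jH_j)θ = H_j(h_jθ) − h_j·H_jθ`. [cite: Balaban1983RegularityDecay, (2.10) p.576] -/
theorem commOp_apply (j : Lab P K K₀) (θ : HiggsLattice.ScalarField P 0 N) :
    commOp C K K₀ Ω A msq a j θ = Hloc C K K₀ Ω A msq a j (hTor K K₀ j • θ) - hTor K K₀ j • Hloc C K K₀ Ω A msq a j θ := rfl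

/-- The letter of `R` at a field. [cite: Balaban1983RegularityDecay, (2.11) p.576] -/
theorem bOp_apply (j : Lab P K K₀) (ψ : HiggsLattice.ScalarField P 0 N) :
    bOp C K K₀ Ω A msq a j ψ
      = -(Hloc C K K₀ Ω A msq a j (hTor K K₀ j • Gloc C K K₀ Ω A msq a j (hTor K K₀ j • ψ))
          - hTor K K₀ j • Hloc C K K₀ Ω A msq a j (Gloc C K K₀ Ω A msq a j (hTor K K₀ j • ψ))) := rfl

/-- `G₀φ = Σ_j h_j·G_j(h_jφ)`. [cite: Balaban1983RegularityDecay, (2.2) p.575] -/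
theorem G0_apply (φ : HiggsLattice.ScalarField P 0 N) :
    G0 C K K₀ Ω A msq a φ = ∑ j : Lab P K K₀, hTor K K₀ j • Gloc C K K₀ Ω A msq a j (hTor K K₀ j • φ) := by
  simp only [G0, LinearMap.coe_sum, Finset.sum_apply, aOp_apply]

/-- `Rφ = Σ_j (bOp j)φ`. [cite: Balaban1983RegularityDecay, (2.11) p.576] -/
theorem Rop_apply (φ : HiggsLattice.ScalarField P 0 N) :
    Rop C K K₀ Ω A msq a φ = ∑ j : Lab P K K₀, bOp C K K₀ Ω A msq a j φ := by
  simp only [Rop, LinearMap.coe_sum, Finset.sum_apply]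

/-- **(2.9)–(2.11) FOR THE REGION: `(−Δ^{ε,N}_{A,Ω} + m² + a_K(L^Kε)^{−2}P_K(A))·G₀ = 1 − R`** (from (2.6) for the region, `H_jG_j = 1`
and `Σ_j h_j² = 1` on the torus, through the abstract `parametrix_identity`; `m² > 0`, `a_K ≥ 0`, `K ≤ K_P`, `K₀ ∣ M_P`, `K₀ ≥ 8`).
[cite: Balaban1983RegularityDecay, (2.9)–(2.11) p.576] -/
theorem covOpK_mul_G0 (hK : K ≤ P.K) (hK₀ : K₀ ∣ P.M) (hK₀8 : 8 ≤ K₀) (hmsq : 0 < msq)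
    (hak : 0 ≤ B1.aSeq a P.L K) :
    covOpK C Ω A msq a K * G0 C K K₀ Ω A msq a = 1 - Rop C K K₀ Ω A msq a := by
  apply LinearMap.ext
  intro φ
  rw [Module.End.mul_apply, G0_apply, LinearMap.sub_apply, Module.End.one_apply, Rop_apply,
    parametrix_identity (covOpK C Ω A msq a K) (Hloc C K K₀ Ω A msq a) (Gloc C K K₀ Ω A msq a)
      (fun j => Hloc_mul_Gloc Ω A hmsq a hak j) (hTor K K₀) (sum_hTor_sq hK hK₀ (one_le_of_eight_le hK₀8))
      (fun j ψ => covOpK_hTor_agree_region C hK hK₀ hK₀8 Ω j A msq a ψ) φ,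
    sub_eq_add_neg, ← Finset.sum_neg_distrib]
  congr 1
  refine Finset.sum_congr rfl fun j _ => ?_
  rw [bOp_apply, neg_neg]

/-- **(2.12), THE REPRESENTATION AS AN IDENTITY: `G_K(Ω, A) = G₀ + G_K(Ω, A)·R`** — i.e. `G_K(Ω,A)(I − R) = G₀`, the content of
«G_k(Ω, A) = G₀(I − R)^{−1} = Σ_n G₀Rⁿ» before any convergence question (the chain file iterates it: `G = Σ_{n<m}G₀Rⁿ + G·R^m`).
[cite: Balaban1983RegularityDecay, (2.12) p.577] -/
theorem propagatorK_eq_G0_add (hK : K ≤ P.K) (hK₀ : K₀ ∣ P.M) (hK₀8 : 8 ≤ K₀) (hmsq : 0 < msq)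
    (hak : 0 ≤ B1.aSeq a P.L K) :
    propagatorK C Ω A msq a K = G0 C K K₀ Ω A msq a + propagatorK C Ω A msq a K * Rop C K K₀ Ω A msq a := by
  have h1 := congrArg (fun T => propagatorK C Ω A msq a K * T)
    (covOpK_mul_G0 (C := C) (K₀ := K₀) Ω A msq a hK hK₀ hK₀8 hmsq hak)
  rw [← mul_assoc, propagatorK_mul_covOpK C Ω A hmsq a K hak, one_mul, mul_sub, mul_one] at h1
  rw [h1]
  abel

end Letters

/-! ## §5 Supports and locality of the letters -/

section Locality

variable (C : ChargeData N) {K K₀ : ℕ}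
variable (Ω : Finset (HiggsLattice.Site P 0)) (A : HiggsLattice.VecField P 0) (msq a : ℝ)

/-- `h_j·ψ` vanishes off `{|x − Mj| ≤ rS}`. [cite: Balaban1983RegularityDecay, (2.7) p.576] -/
theorem hTor_smul_apply_eq_zero (hK : K ≤ P.K) (hK₀ : K₀ ∣ P.M) (hK₀8 : 8 ≤ K₀) (j : Lab P K K₀)
    (ψ : HiggsLattice.ScalarField P 0 N) {x : HiggsLattice.Site P 0} (hx : ¬ Near K K₀ (rS P K K₀) j x) :
    (hTor K K₀ j • ψ) x = 0 := by
  have h0 : hTor K K₀ j x = 0 := by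
    by_contra h; exact hx (near_rS_of_hTor_ne_zero hK hK₀ hK₀8 h)
  rw [Pi.smul_apply', h0, zero_smul]

/-- `h_j·ψ = 0` if `ψ` vanishes on `{|x − Mj| ≤ rS}`. [cite: Balaban1983RegularityDecay, (2.7) p.576] -/
theorem hTor_smul_eq_zero_of (hK : K ≤ P.K) (hK₀ : K₀ ∣ P.M) (hK₀8 : 8 ≤ K₀) (j : Lab P K K₀)
    (ψ : HiggsLattice.ScalarField P 0 N) (hψ : ∀ x, Near K K₀ (rS P K K₀) j x → ψ x = 0) : hTor K K₀ j • ψ = 0 := by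
  funext x
  by_cases hx : Near K K₀ (rS P K K₀) j x
  · rw [Pi.smul_apply', hψ x hx, smul_zero, Pi.zero_apply]
  · rw [hTor_smul_apply_eq_zero hK hK₀ hK₀8 j ψ hx, Pi.zero_apply]

/-- OUTPUT SUPPORT OF `h_jG_jh_j`: `(aOp j ψ)(x) = 0` off `{|x − Mj| ≤ rS}`. [cite: Balaban1983RegularityDecay, (2.13) p.577] -/
theorem aOp_apply_eq_zero_off (hK : K ≤ P.K) (hK₀ : K₀ ∣ P.M) (hK₀8 : 8 ≤ K₀) (j : Lab P K K₀)
    (ψ : HiggsLattice.ScalarField P 0 N) {x : HiggsLattice.Site P 0} (hx : ¬ Near K K₀ (rS P K K₀) j x) :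
    aOp C K K₀ Ω A msq a j ψ x = 0 := by
  rw [aOp_apply]
  exact hTor_smul_apply_eq_zero hK hK₀ hK₀8 j _ hx

/-- OUTPUT SUPPORT OF THE `R`-LETTER: `(bOp j ψ)(x) = 0` off `{|x − Mj| ≤ rS}` (row support of `K_j`). [cite: Balaban1983RegularityDecay, (2.13) p.577] -/
theorem bOp_apply_eq_zero_off (hK : K ≤ P.K) (hK₀ : K₀ ∣ P.M) (hK₀8 : 8 ≤ K₀) (j : Lab P K K₀)
    (ψ : HiggsLattice.ScalarField P 0 N) {x : HiggsLattice.Site P 0} (hx : ¬ Near K K₀ (rS P K K₀) j x) :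
    bOp C K K₀ Ω A msq a j ψ x = 0 := by
  rw [bOp_apply, Pi.neg_apply, Hloc_commutator_row_zero C hK hK₀ hK₀8 Ω A msq a j _ hx, neg_zero]

/-- INPUT SUPPORT OF `h_jG_jh_j`: `aOp j ψ = 0` if `ψ` vanishes on `{|x − Mj| ≤ rS}`. [cite: Balaban1983RegularityDecay, (2.13) p.577] -/
theorem aOp_apply_eq_zero_of (hK : K ≤ P.K) (hK₀ : K₀ ∣ P.M) (hK₀8 : 8 ≤ K₀) (j : Lab P K K₀)
    (ψ : HiggsLattice.ScalarField P 0 N) (hψ : ∀ x, Near K K₀ (rS P K K₀) j x → ψ x = 0) :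
    aOp C K K₀ Ω A msq a j ψ = 0 := by
  rw [aOp_apply, hTor_smul_eq_zero_of hK hK₀ hK₀8 j ψ hψ, map_zero, smul_zero]

/-- INPUT SUPPORT OF THE `R`-LETTER: `bOp j ψ = 0` if `ψ` vanishes on `{|x − Mj| ≤ rS}`. [cite: Balaban1983RegularityDecay, (2.13) p.577] -/
theorem bOp_apply_eq_zero_of (hK : K ≤ P.K) (hK₀ : K₀ ∣ P.M) (hK₀8 : 8 ≤ K₀) (j : Lab P K K₀)
    (ψ : HiggsLattice.ScalarField P 0 N) (hψ : ∀ x, Near K K₀ (rS P K K₀) j x → ψ x = 0) :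
    bOp C K K₀ Ω A msq a j ψ = 0 := by
  rw [bOp_apply, hTor_smul_eq_zero_of hK hK₀ hK₀8 j ψ hψ, map_zero, smul_zero, map_zero]
  simp

/-- **LOCALITY `a_i·b_l = 0`** for labels whose `rS`-cores are disjoint («either both points belong to □_{ω_i}, or none» — the
«obvious fact» turning (2.12) into the walk sum (2.13)). [cite: Balaban1983RegularityDecay, (2.13) p.577] -/
theorem aOp_mul_bOp_eq_zero (hK : K ≤ P.K) (hK₀ : K₀ ∣ P.M) (hK₀8 : 8 ≤ K₀) (i l : Lab P K K₀)
    (h : ∀ x : HiggsLattice.Site P 0, ¬ (Near K K₀ (rS P K K₀) i x ∧ Near K K₀ (rS P K K₀) l x)) :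
    aOp C K K₀ Ω A msq a i * bOp C K K₀ Ω A msq a l = 0 := by
  apply LinearMap.ext
  intro ψ
  rw [Module.End.mul_apply, LinearMap.zero_apply]
  exact aOp_apply_eq_zero_of C Ω A msq a hK hK₀ hK₀8 i _ fun x hx =>
    bOp_apply_eq_zero_off C Ω A msq a hK hK₀ hK₀8 l ψ fun hl => h x ⟨hx, hl⟩

/-- **LOCALITY `b_i·b_l = 0`** for labels whose `rS`-cores are disjoint. [cite: Balaban1983RegularityDecay, (2.13) p.577] -/
theorem bOp_mul_bOp_eq_zero (hK : K ≤ P.K) (hK₀ : K₀ ∣ P.M) (hK₀8 : 8 ≤ K₀) (i l : Lab P K K₀)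
    (h : ∀ x : HiggsLattice.Site P 0, ¬ (Near K K₀ (rS P K K₀) i x ∧ Near K K₀ (rS P K K₀) l x)) :
    bOp C K K₀ Ω A msq a i * bOp C K K₀ Ω A msq a l = 0 := by
  apply LinearMap.ext
  intro ψ
  rw [Module.End.mul_apply, LinearMap.zero_apply]
  exact bOp_apply_eq_zero_of C Ω A msq a hK hK₀ hK₀8 i _ fun x hx =>
    bOp_apply_eq_zero_off C Ω A msq a hK hK₀ hK₀8 l ψ fun hl => h x ⟨hx, hl⟩

/-- `a_iψ = 0` when `ψ` vanishes on the core of `□_i` — e.g. `f` supported away from `□_i` («supp f ⊂ □_{ω_n}»).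
[cite: Balaban1983RegularityDecay, (2.18) p.578] -/
theorem aOp_apply_eq_zero_of_support (hK : K ≤ P.K) (hK₀ : K₀ ∣ P.M) (hK₀8 : 8 ≤ K₀) (i : Lab P K K₀)
    (f : HiggsLattice.ScalarField P 0 N) (hf : ∀ z, f z ≠ 0 → ¬ Near K K₀ (rS P K K₀) i z) :
    aOp C K K₀ Ω A msq a i f = 0 :=
  aOp_apply_eq_zero_of C Ω A msq a hK hK₀ hK₀8 i f fun x hx => by
    by_contra hne; exact hf x hne hx

/-- `b_iψ = 0` when `ψ` vanishes on the core of `□_i`. [cite: Balaban1983RegularityDecay, (2.18) p.578] -/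
theorem bOp_apply_eq_zero_of_support (hK : K ≤ P.K) (hK₀ : K₀ ∣ P.M) (hK₀8 : 8 ≤ K₀) (i : Lab P K K₀)
    (f : HiggsLattice.ScalarField P 0 N) (hf : ∀ z, f z ≠ 0 → ¬ Near K K₀ (rS P K K₀) i z) :
    bOp C K K₀ Ω A msq a i f = 0 :=
  bOp_apply_eq_zero_of C Ω A msq a hK hK₀ hK₀8 i f fun x hx => by
    by_contra hne; exact hf x hne hx

/-- **THE PROBE OF `h_iG_ih_i` AT A SITE**: `(a_ig)(x) = 0` unless `|x − Mi| ≤ rS` («x, x′ ∈ □_{ω₀}»: the start of the walk is one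
of the `≤ 2^d` cubes seeing `x`), and `‖(a_ig)(x)‖ ≤ γ‖g‖_∞` whenever the cube propagator has the sup letter
`‖G_i(h_iψ)‖_∞ ≤ γ‖ψ‖_∞` ((2.16)/(2.17), first letter). [cite: Balaban1983RegularityDecay, (2.18) p.578, (2.20) p.578] -/
theorem aOp_apply_norm_le (hK : K ≤ P.K) (hK₀ : K₀ ∣ P.M) (hK₀8 : 8 ≤ K₀) (i : Lab P K K₀) {γ : ℝ}
    (hG : ∀ ψ : HiggsLattice.ScalarField P 0 N, ‖Gloc C K K₀ Ω A msq a i (hTor K K₀ i • ψ)‖ ≤ γ * ‖ψ‖)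
    (g : HiggsLattice.ScalarField P 0 N) (x : HiggsLattice.Site P 0) :
    ‖aOp C K K₀ Ω A msq a i g x‖ ≤ γ * ‖g‖ := by
  have hK₀' := one_le_of_eight_le hK₀8
  rw [aOp_apply, Pi.smul_apply', norm_smul]
  calc ‖hTor K K₀ i x‖ * ‖Gloc C K K₀ Ω A msq a i (hTor K K₀ i • g) x‖
      ≤ 1 * (γ * ‖g‖) :=
        mul_le_mul (by rw [Real.norm_eq_abs]; exact abs_hTor_le_one hK hK₀ hK₀' i x)
          ((norm_le_pi_norm _ x).trans (hG g)) (norm_nonneg _) zero_le_one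
    _ = γ * ‖g‖ := one_mul _

/-- **ROW MULTIPLICITY OF THE CORES**: at most `2^d` labels `i` have `|x − Mi| ≤ rS` (gen 8's `card_filter_near_le` at `r = rS < M`).
[cite: Balaban1983RegularityDecay, §2 pp.575–576] -/
theorem card_filter_near_rS_le (hK : K ≤ P.K) (hK₀ : K₀ ∣ P.M) (hK₀8 : 8 ≤ K₀) (x : HiggsLattice.Site P 0) :
    (Finset.univ.filter fun j : Lab P K K₀ => Near K K₀ (rS P K K₀) j x).card ≤ 2 ^ P.d :=
  card_filter_near_le hK hK₀ (one_le_of_eight_le hK₀8) (lt_trans (Nat.lt_succ_self _) (rS_succ_lt_half hK₀8)) x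

end Locality

end Literature.MathematicalPhysics.QuantumFieldTheory.Balaban1983to89.B1TorusRegionCubes
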